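import Literature.Topology.PlaneTopology.ChartParity
import HarnessLib

/-!
# Winding numbers of images of homotopic loops

Topic: Topology / PlaneTopology, sequel to `WindingNumber.lean`, `ChartParity.lean`
(`wind_eq_of_homotopy`). Loops of a space `Y` given as `Path`s on the unit interval are read on
`[0, 1]` through `Set.projIcc` (`pathLoop`), and we record: **homotopic loops of `Y` have images
with the same winding number about any point missed by the image of the map `Φ : Y → ℂ`**
(`wind_pathLoop_eq_of_homotopic`), in particular **null-homotopic loops have images of winding
number `0`** (`wind_pathLoop_eq_zero_of_homotopic_refl`). Used for the loops tracked along
leaves of planar foliations (null in an open leaf, powers of the injective loop in a closed one).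

All statements are [folklore].
-/

noncomputable section

open Set Function unitInterval
open _root_.Topology

namespace Literature.Topology.PlaneTopology

variable {Y : Type*} [TopologicalSpace Y]

/-- **A path of `Y` composed with `Φ : Y → ℂ`, read as a map on `ℝ`** (constant outside `[0, 1]`).
[folklore] -/
def pathLoop (Φ : Y → ℂ) {a b : Y} (c : Path a b) (t : ℝ) : ℂ := Φ (c (projIcc 0 1 zero_le_one t))

/-- Values on `[0, 1]`. [folklore] -/
theorem pathLoop_apply_of_mem (Φ : Y → ℂ) {a b : Y} (c : Path a b) {t : ℝ} (ht : t ∈ Icc (0 : ℝ) 1) :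
    pathLoop Φ c t = Φ (c ⟨t, ht⟩) := by
  rw [pathLoop, projIcc_of_mem _ ht]

/-- At `0`. [folklore] -/
@[simp] theorem pathLoop_zero (Φ : Y → ℂ) {a b : Y} (c : Path a b) : pathLoop Φ c 0 = Φ a := by
  rw [pathLoop, projIcc_left]; show Φ (c 0) = Φ a; rw [c.source]

/-- At `1`. [folklore] -/
@[simp] theorem pathLoop_one (Φ : Y → ℂ) {a b : Y} (c : Path a b) : pathLoop Φ c 1 = Φ b := by
  rw [pathLoop, projIcc_right]; show Φ (c 1) = Φ b; rw [c.target]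

/-- The read loop is continuous. [folklore] -/
theorem continuous_pathLoop {Φ : Y → ℂ} (hΦ : Continuous Φ) {a b : Y} (c : Path a b) : Continuous (pathLoop Φ c) :=
  hΦ.comp (c.continuous.comp continuous_projIcc)

/-- **Homotopic loops have images with the same winding number** about a point off the image of
`Φ`. [folklore] -/
theorem wind_pathLoop_eq_of_homotopic {Φ : Y → ℂ} (hΦ : Continuous Φ) {a : Y} {c₁ c₂ : Path a a}
    (h : c₁.Homotopic c₂) {p : ℂ} (hp : ∀ y, Φ y ≠ p) :
    wind (fun t ↦ pathLoop Φ c₁ t - p) = wind (fun t ↦ pathLoop Φ c₂ t - p) := by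
  obtain ⟨H⟩ := h
  have key := wind_eq_of_homotopy
    (H := fun s t ↦ Φ (H (projIcc 0 1 zero_le_one s, projIcc 0 1 zero_le_one t)) - p) ?_ ?_ ?_
  · -- identify the two ends
    have h0 : (fun t ↦ Φ (H (projIcc 0 1 zero_le_one 0, projIcc 0 1 zero_le_one t)) - p) = fun t ↦ pathLoop Φ c₁ t - p := by
      funext t
      rw [projIcc_left]
      show Φ (H (0, projIcc 0 1 zero_le_one t)) - p = Φ (c₁ (projIcc 0 1 zero_le_one t)) - p
      rw [H.apply_zero]; rfl
    have h1 : (fun t ↦ Φ (H (projIcc 0 1 zero_le_one 1, projIcc 0 1 zero_le_one t)) - p) = fun t ↦ pathLoop Φ c₂ t - p := by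
      funext t
      rw [projIcc_right]
      show Φ (H (1, projIcc 0 1 zero_le_one t)) - p = Φ (c₂ (projIcc 0 1 zero_le_one t)) - p
      rw [H.apply_one]; rfl
    rw [h0, h1] at key
    exact key
  · exact (((hΦ.comp H.continuous).comp (continuous_projIcc.prodMap continuous_projIcc)).sub continuous_const).continuousOn
  · intro s _
    show Φ (H (_, projIcc 0 1 zero_le_one 0)) - p = Φ (H (_, projIcc 0 1 zero_le_one 1)) - p
    rw [projIcc_left, projIcc_right]
    show Φ (H (projIcc 0 1 zero_le_one s, 0)) - p = Φ (H (projIcc 0 1 zero_le_one s, 1)) - p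
    rw [H.source, H.target]
  · exact fun s _ t _ ↦ sub_ne_zero.2 (hp _)

/-- **Null-homotopic loops have images of winding number `0`** about a point off the image of
`Φ`. [folklore] -/
theorem wind_pathLoop_eq_zero_of_homotopic_refl {Φ : Y → ℂ} (hΦ : Continuous Φ) {a : Y} {c : Path a a}
    (h : c.Homotopic (Path.refl a)) {p : ℂ} (hp : ∀ y, Φ y ≠ p) : wind (fun t ↦ pathLoop Φ c t - p) = 0 := by
  rw [wind_pathLoop_eq_of_homotopic hΦ h hp]
  have : (fun t ↦ pathLoop Φ (Path.refl a) t - p) = fun _ ↦ Φ a - p := by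
    funext t; simp [pathLoop]
  rw [this, wind_const]

end Literature.Topology.PlaneTopology
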